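import Literature.Analysis.Complex.PositiveForms
import HarnessLib

/-!
# `(1,1)`-forms are spanned by the strongly positive generators `i α∧ᾱ` (Demailly, Lemma III.1.4, bidegree `(1,1)`)

Topic `Literature/Analysis/Complex`; lane `lit-hodgefound` (Track 2 foundations library), prover
seat `lit-hodgefound-p06`, self-claimed row g24-#6; sequel of `PositiveForms.lean` (Demailly,
*Complex Analytic and Differential Geometry*, Ch. III §1.A, pointwise).

Demailly's Lemma III.1.4 — the real `(p,p)`-forms admit a basis of strongly positive forms — rests
on the polarization identity "`dz_j ∧ dz̄_k = ¼ Σ_{s<4} iˢ (dz_j + iˢdz_k) ∧ conj(dz_j + iˢdz_k)`"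
(agbook p. 130, proof of Lemma 1.4). Here, in bidegree `(1,1)` and on a finite-dimensional complex
normed space `V` (forms `V [⋀^Fin 2]→L[ℝ] ℂ` of pointwise type `(1,1)`, generators
`elem α = i α∧ᾱ` of `PositiveForms.lean`):

* `hermForm_smul_right'`, `hermForm_sum_smul_right'` — the hermitian form `h` of (1.8) is
  conjugate-linear in its second variable for EVERY `2`-form (the tree's `hermForm_smul_right`
  assumed the form real of type `(1,1)`);
* `eq_of_hermForm_eq` — a `(1,1)`-form is determined by its hermitian form;
* `hermForm_polar` — **polarization**: `h(¼[(iγ₀∧γ̄₀ - iγ₂∧γ̄₂) + i(iγ₁∧γ̄₁ - iγ₃∧γ̄₃)]) = ℓ ⊗ m̄`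
  for `γ_s = ℓ + iˢ m`;
* **`IsOfTypeAt.mem_span_elem`** — every `(1,1)`-form is a `ℂ`-linear combination of forms
  `i γ∧γ̄` (Lemma 1.4 over `ℂ`, bidegree `(1,1)`);
* **`IsOfTypeAt.mem_span_real_elem`** — every REAL `(1,1)`-form is a REAL linear combination of
  forms `i γ∧γ̄`, i.e. a difference of two strongly positive `(1,1)`-forms (Lemma III.1.4 as
  printed, bidegree `(1,1)`).

Theorems only; no definitions, no named facts.

## References

* [DemaillyAGBook] J.-P. Demailly, *Complex Analytic and Differential Geometry* (version of June 21,
  2012), Ch. III §1.A, Lemma 1.4 and its proof, (1.8).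
-/

noncomputable section

open scoped ComplexOrder ComplexConjugate
open Complex Function ContinuousAlternatingMap Module
open Literature.LinearAlgebra.Alternating (conjForm conjForm_apply)

namespace Literature.Analysis.Complex.PositiveForm

variable {V : Type*} [NormedAddCommGroup V] [NormedSpace ℂ V]

/-! ### The hermitian form is sesquilinear for every `(1,1)`-form -/

section Sesquilinear

variable {u : V [⋀^Fin 2]→L[ℝ] ℂ}

omit [NormedAddCommGroup V] [NormedSpace ℂ V] in
/-- A `2`-vector of arguments is the pair of its entries. [folklore] -/
private theorem eq_vec2' (v : Fin 2 → V) : v = ![v 0, v 1] := by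
  ext i; fin_cases i <;> rfl

/-- `h(ξ, Iη) = -i h(ξ, η)` (for every `2`-form). [cite: DemaillyAGBook, Ch. III (1.8)] -/
theorem hermForm_I_smul_right (ξ η : V) : hermForm u ξ (I • η) = -I * hermForm u ξ η := by
  rw [hermForm, hermForm, smul_smul, I_mul_I, neg_one_smul, apply_pair_neg_right]
  ring_nf
  rw [Complex.I_sq]; ring

/-- `h` is conjugate-linear in the second variable (for every `2`-form).
[cite: DemaillyAGBook, Ch. III (1.8)] -/
theorem hermForm_smul_right' (c : ℂ) (ξ η : V) :
    hermForm u ξ (c • η) = conj c * hermForm u ξ η := by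
  have hre : ∀ (r : ℝ) (ζ : V), hermForm u ξ ((r : ℂ) • ζ) = r * hermForm u ξ ζ := fun r ζ ↦ by
    rw [Complex.coe_smul, hermForm, hermForm, smul_comm, apply_pair_smul_right, apply_pair_smul_right]
    ring
  conv_lhs => rw [← Complex.re_add_im c, add_smul, mul_smul, hermForm_add_right, hre, hre,
    hermForm_I_smul_right]
  rw [← Complex.re_add_im c, map_add, map_mul, Complex.conj_ofReal, Complex.conj_ofReal,
    Complex.conj_I, Complex.re_add_im]
  ring

/-- Sums in the second variable (every `2`-form). [cite: DemaillyAGBook, Ch. III (1.8)] -/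
theorem hermForm_sum_smul_right' {ι : Type*} (s : Finset ι) (ξ : V)
    (y : ι → ℂ) (e : ι → V) :
    hermForm u ξ (∑ j ∈ s, y j • e j) = ∑ j ∈ s, conj (y j) * hermForm u ξ (e j) := by
  classical
  induction s using Finset.induction_on with
  | empty =>
    simpa using (show hermForm u ξ ((0 : ℝ) • ξ) = 0 by
      rw [hermForm, smul_comm, apply_pair_smul_right, apply_pair_smul_right]; simp)
  | insert a s ha ih =>
    rw [Finset.sum_insert ha, Finset.sum_insert ha, hermForm_add_right, hermForm_smul_right', ih]

/-- **A `(1,1)`-form is determined by its hermitian form** (`u(ξ,η) = i(h(ξ,η) - h(η,ξ))`).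
[cite: DemaillyAGBook, Ch. III (1.8)] -/
theorem eq_of_hermForm_eq {w : V [⋀^Fin 2]→L[ℝ] ℂ} (hu : IsOfTypeAt 1 1 u) (hw : IsOfTypeAt 1 1 w)
    (h : ∀ ξ η, hermForm u ξ η = hermForm w ξ η) : u = w := by
  ext v
  rw [eq_vec2' v, apply_pair_eq_I_mul_hermForm_sub hu, apply_pair_eq_I_mul_hermForm_sub hw, h, h]

/-- The hermitian form depends additively on the form. [cite: DemaillyAGBook, Ch. III (1.8)] -/
theorem hermForm_add_form (u w : V [⋀^Fin 2]→L[ℝ] ℂ) (ξ η : V) :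
    hermForm (u + w) ξ η = hermForm u ξ η + hermForm w ξ η := by
  simp only [hermForm, ContinuousAlternatingMap.add_apply]; ring

/-- The hermitian form depends `ℂ`-linearly on the form. [cite: DemaillyAGBook, Ch. III (1.8)] -/
theorem hermForm_smul_form (c : ℂ) (u : V [⋀^Fin 2]→L[ℝ] ℂ) (ξ η : V) :
    hermForm (c • u) ξ η = c * hermForm u ξ η := by
  simp only [hermForm, ContinuousAlternatingMap.smul_apply, smul_eq_mul]; ring

/-- The hermitian form depends subtractively on the form. [cite: DemaillyAGBook, Ch. III (1.8)] -/
theorem hermForm_sub_form (u w : V [⋀^Fin 2]→L[ℝ] ℂ) (ξ η : V) :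
    hermForm (u - w) ξ η = hermForm u ξ η - hermForm w ξ η := by
  simp only [hermForm, ContinuousAlternatingMap.sub_apply]; ring

/-- The hermitian form of a finite sum of forms. [cite: DemaillyAGBook, Ch. III (1.8)] -/
theorem hermForm_sum_form {ι : Type*} (s : Finset ι) (u : ι → V [⋀^Fin 2]→L[ℝ] ℂ) (ξ η : V) :
    hermForm (∑ i ∈ s, u i) ξ η = ∑ i ∈ s, hermForm (u i) ξ η := by
  classical
  induction s using Finset.induction_on with
  | empty => simp [hermForm]
  | insert a s ha ih => rw [Finset.sum_insert ha, Finset.sum_insert ha, hermForm_add_form, ih]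

end Sesquilinear

/-! ### Polarization -/

section Polar

/-- **Polarization** (Demailly, proof of Lemma III.1.4:
`4 ℓ⊗m̄ = Σ_{s<4} iˢ (ℓ + iˢm) ⊗ conj(ℓ + iˢm)`): the hermitian form of
`¼[(iγ₀∧γ̄₀ - iγ₂∧γ̄₂) + i(iγ₁∧γ̄₁ - iγ₃∧γ̄₃)]`, `γ_s = ℓ + iˢ m`, is `(ξ, η) ↦ ℓ(ξ) conj m(η)`.
[cite: DemaillyAGBook, Ch. III Lemma 1.4 (proof)] -/
theorem hermForm_polar (ℓ m : V →L[ℂ] ℂ) (ξ η : V) :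
    hermForm ((4 : ℂ)⁻¹ • ((elem (ℓ + m) - elem (ℓ - m)) + I • (elem (ℓ + I • m) - elem (ℓ - I • m))))
      ξ η = ℓ ξ * conj (m η) := by
  simp only [hermForm_smul_form, hermForm_add_form, hermForm_sub_form, hermForm_elem]
  simp [Complex.conj_I]
  ring_nf
  simp only [Complex.I_sq]
  ring

/-- The polarized combination is of type `(1,1)`. [cite: DemaillyAGBook, Ch. III Lemma 1.4 (proof)] -/
theorem isOfTypeAt_polar (ℓ m : V →L[ℂ] ℂ) :
    IsOfTypeAt 1 1 ((4 : ℂ)⁻¹ • ((elem (ℓ + m) - elem (ℓ - m)) +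
      I • (elem (ℓ + I • m) - elem (ℓ - I • m))) : V [⋀^Fin 2]→L[ℝ] ℂ) := by
  rw [← mem_typeSubmodule_iff_isOfTypeAt rfl]
  have he : ∀ γ : V →L[ℂ] ℂ, elem γ ∈ typeSubmodule V 2 1 1 := fun γ ↦
    (isOfTypeAt_elem γ).mem_typeSubmodule
  exact Submodule.smul_mem _ _ (Submodule.add_mem _ (Submodule.sub_mem _ (he _) (he _))
    (Submodule.smul_mem _ _ (Submodule.sub_mem _ (he _) (he _))))

/-- The polarized combination lies in the `ℂ`-span of the generators `i γ∧γ̄`.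
[cite: DemaillyAGBook, Ch. III Lemma 1.4 (proof)] -/
theorem polar_mem_span_elem (ℓ m : V →L[ℂ] ℂ) :
    ((4 : ℂ)⁻¹ • ((elem (ℓ + m) - elem (ℓ - m)) + I • (elem (ℓ + I • m) - elem (ℓ - I • m))) :
      V [⋀^Fin 2]→L[ℝ] ℂ) ∈ Submodule.span ℂ (Set.range (elem (V := V))) := by
  have he : ∀ γ : V →L[ℂ] ℂ, elem γ ∈ Submodule.span ℂ (Set.range (elem (V := V))) := fun γ ↦
    Submodule.subset_span ⟨γ, rfl⟩
  exact Submodule.smul_mem _ _ (Submodule.add_mem _ (Submodule.sub_mem _ (he _) (he _))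
    (Submodule.smul_mem _ _ (Submodule.sub_mem _ (he _) (he _))))

end Polar

/-! ### Lemma III.1.4 in bidegree `(1,1)` -/

section Span

/-- **Every `(1,1)`-form is a `ℂ`-linear combination of the strongly positive generators `i γ∧γ̄`**
(Demailly, Lemma III.1.4 over `ℂ`, bidegree `(1,1)`: expand the hermitian form of `u` in a basis,
`h(ξ,η) = Σ_{j,k} h(b_j,b_k) ξ_j η̄_k`, and polarize each `dz_j ⊗ dz̄_k`).
[cite: DemaillyAGBook, Ch. III Lemma 1.4] -/
theorem _root_.Literature.Analysis.Complex.IsOfTypeAt.mem_span_elem [FiniteDimensional ℂ V]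
    {u : V [⋀^Fin 2]→L[ℝ] ℂ} (h11 : IsOfTypeAt 1 1 u) :
    u ∈ Submodule.span ℂ (Set.range (elem (V := V))) := by
  classical
  let b : Basis (Fin (finrank ℂ V)) ℂ V := Module.finBasis ℂ V
  let β : Fin (finrank ℂ V) → (V →L[ℂ] ℂ) := fun j ↦ LinearMap.toContinuousLinearMap (b.coord j)
  have hβ : ∀ j ξ, β j ξ = b.repr ξ j := fun j ξ ↦ by simp [β, Basis.coord_apply]
  -- the polarized forms `P j k` with `h(P j k)(ξ, η) = ξ_j conj η_k`
  let P : Fin (finrank ℂ V) → Fin (finrank ℂ V) → V [⋀^Fin 2]→L[ℝ] ℂ := fun j k ↦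
    (4 : ℂ)⁻¹ • ((elem (β j + β k) - elem (β j - β k)) +
      I • (elem (β j + I • β k) - elem (β j - I • β k)))
  have hP : ∀ j k ξ η, hermForm (P j k) ξ η = β j ξ * conj (β k η) := fun j k ξ η ↦
    hermForm_polar _ _ _ _
  let w : V [⋀^Fin 2]→L[ℝ] ℂ := ∑ j, ∑ k, hermForm u (b j) (b k) • P j k
  have hw11 : IsOfTypeAt 1 1 w := by
    rw [← mem_typeSubmodule_iff_isOfTypeAt rfl]
    exact Submodule.sum_mem _ fun j _ ↦ Submodule.sum_mem _ fun k _ ↦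
      Submodule.smul_mem _ _ (isOfTypeAt_polar _ _).mem_typeSubmodule
  have huw : u = w := by
    refine eq_of_hermForm_eq h11 hw11 fun ξ η ↦ ?_
    -- expand `h(ξ, η)` in the basis
    have lhs : hermForm u ξ η = ∑ j, ∑ k, b.repr ξ j * conj (b.repr η k) * hermForm u (b j) (b k) := by
      conv_lhs => rw [← b.sum_repr ξ, ← b.sum_repr η, hermForm_sum_smul_left h11]
      simp only [hermForm_sum_smul_right', Finset.mul_sum]
      refine Finset.sum_congr rfl fun j _ ↦ Finset.sum_congr rfl fun k _ ↦ ?_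
      ring
    rw [lhs]
    simp only [w, hermForm_sum_form, hermForm_smul_form, hP, hβ]
    refine Finset.sum_congr rfl fun j _ ↦ Finset.sum_congr rfl fun k _ ↦ ?_
    ring
  rw [huw]
  exact Submodule.sum_mem _ fun j _ ↦ Submodule.sum_mem _ fun k _ ↦
    Submodule.smul_mem _ _ (polar_mem_span_elem _ _)

/-- Conjugation of forms is additive. [folklore] -/
private theorem conjForm_add' {k : ℕ} (η η' : V [⋀^Fin k]→L[ℝ] ℂ) :
    conjForm (η + η') = conjForm η + conjForm η' := by
  ext v; simp [conjForm_apply]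

/-- Conjugation of forms is conjugate-linear. [folklore] -/
private theorem conjForm_smul' {k : ℕ} (c : ℂ) (η : V [⋀^Fin k]→L[ℝ] ℂ) :
    conjForm (c • η) = conj c • conjForm η := by
  ext v; simp [conjForm_apply]

/-- Conjugation of a `Finsupp` combination of forms. [folklore] -/
private theorem conjForm_finsupp_sum {k : ℕ} {ι : Type*} (c : ι →₀ ℂ) (g : ι → V [⋀^Fin k]→L[ℝ] ℂ) :
    conjForm (c.sum fun i a ↦ a • g i) = c.sum fun i a ↦ conj a • conjForm (g i) := by
  classical
  unfold Finsupp.sum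
  induction c.support using Finset.induction_on with
  | empty => ext v; simp
  | insert a s ha ih => rw [Finset.sum_insert ha, Finset.sum_insert ha, conjForm_add', conjForm_smul', ih]

/-- **Lemma III.1.4 in bidegree `(1,1)`, as printed: every REAL `(1,1)`-form is a REAL linear
combination of the strongly positive generators `i γ∧γ̄`** (so the real `(1,1)`-forms are spanned
by strongly positive ones; from the complex expansion `u = Σ cᵢ · iγᵢ∧γ̄ᵢ` and `ū = u`, `iγ∧γ̄`
being real, `u = Σ (Re cᵢ) · iγᵢ∧γ̄ᵢ`). [cite: DemaillyAGBook, Ch. III Lemma 1.4] -/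
theorem _root_.Literature.Analysis.Complex.IsOfTypeAt.mem_span_real_elem [FiniteDimensional ℂ V]
    {u : V [⋀^Fin 2]→L[ℝ] ℂ} (h11 : IsOfTypeAt 1 1 u) (hre : conjForm u = u) :
    u ∈ Submodule.span ℝ (Set.range (elem (V := V))) := by
  obtain ⟨c, hc⟩ := (Finsupp.mem_span_range_iff_exists_finsupp).1 h11.mem_span_elem
  -- `u = Σ cᵢ • elem γᵢ`, and conjugating, `u = Σ conj cᵢ • elem γᵢ`
  have hconj : u = c.sum fun γ a ↦ conj a • elem γ := by
    conv_lhs => rw [← hre, ← hc, conjForm_finsupp_sum]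
    simp only [conjForm_elem]
  have hu : u = c.sum fun γ a ↦ (a.re : ℝ) • elem γ :=
    calc u = (2⁻¹ : ℂ) • (u + u) := by rw [← two_smul ℂ u, smul_smul]; norm_num
      _ = (2⁻¹ : ℂ) • ((c.sum fun γ a ↦ a • elem γ) + c.sum fun γ a ↦ conj a • elem γ) := by
        rw [hc, ← hconj]
      _ = c.sum fun γ a ↦ (a.re : ℝ) • elem γ := by
        rw [← Finsupp.sum_add, Finsupp.smul_sum]
        refine Finsupp.sum_congr fun γ _ ↦ ?_
        ext v
        simp only [ContinuousAlternatingMap.smul_apply, ContinuousAlternatingMap.add_apply, smul_eq_mul,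
          Complex.real_smul]
        rw [← add_mul, Complex.add_conj]
        push_cast
        ring
  rw [hu]
  unfold Finsupp.sum
  exact Submodule.sum_mem _ fun γ _ ↦ Submodule.smul_mem _ _ (Submodule.subset_span ⟨γ, rfl⟩)

end Span

end Literature.Analysis.Complex.PositiveForm

end
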